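import Literature.Algebra.EuclideanLattices.LatticePoissonSummation
import HarnessLib

/-!
# Poisson summation for a summable FAMILY of functions over a Euclidean lattice

Topic `Literature/Algebra/EuclideanLattices`, continuing `LatticePoissonSummation`
(`hasSum_echar_tsum_of_summable`: pointwise Poisson summation for one function `h`). For lattice
sums over an invariant point set decomposed into lattice orbits one needs the same identity for a
countable family `(h_q)_q` at once, with the Fourier side summed over `q` INSIDE each mode:

* **`hasSum_echar_tsum_tsum_of_summable`** — if every `h_q` is continuous and integrable, the
  translates are jointly normally summable near the fundamental domain
  (`‖h_q (x + ℓ)‖ ≤ M q ℓ` for `‖x‖ ≤ R`, `∑_{q,ℓ} M q ℓ < ∞`) and the Fourier transforms are jointly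
  absolutely summable over the dual vectors (`∑_{q,k} ‖𝓕 h_q (dualVec L k)‖ < ∞`), then for every `x`
  `∑_q ∑_{ℓ ∈ L} h_q (x + ℓ) = (vol fdom)⁻¹ ∑_k (∑_q 𝓕 h_q (dualVec L k)) · echar L k x`,
  all series converging absolutely (apply the one-function theorem to each `q`, then interchange the
  `q`- and `k`-sums by absolute convergence of the double series, `‖echar L k x‖ = 1`).

[cite: Grafakos2014, Thm 3.2.8]

## Mathlib / tree search

Tree: `LatticePeriodic.hasSum_echar_tsum_of_summable`, `norm_echar`, `fdom`, `rBasis_span`.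
Mathlib: `ZSpan.fract_mem_fundamentalDomain`, `ZSpan.fract_apply`, `Equiv.summable_iff`,
`Summable.of_norm_bounded`, `Summable.prod_factor`, `Summable.prod_symm`, `HasSum.prod_fiberwise`,
`Equiv.hasSum_iff`, `Equiv.prodComm`.
-/

noncomputable section

open MeasureTheory Module Submodule Filter Topology Complex Finset ZSpan
open scoped Real FourierTransform RealInnerProductSpace

namespace Literature.Algebra.EuclideanLattices.LatticePeriodic

variable {E : Type*} [NormedAddCommGroup E] [InnerProductSpace ℝ E] [FiniteDimensional ℝ E]
  [MeasurableSpace E] [BorelSpace E]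
variable (L : Submodule ℤ E) [DiscreteTopology L] [IsZLattice ℝ L]

/-- **Poisson summation for a summable family.** Let `(h_q)_q` be continuous integrable functions
`E → ℂ` whose lattice translates are jointly normally summable on a ball containing a neighbourhood
of the fundamental domain (`‖h_q (x + ℓ)‖ ≤ M q ℓ` for `‖x‖ ≤ R`, `∑_{q,ℓ} M q ℓ < ∞`, `‖x‖ + 1 ≤ R`
on `fdom L`) and whose Fourier transforms are jointly absolutely summable over the dual vectors.
Then for every `x` the translates `h_q (x + ℓ)` are summable over `(q, ℓ)` and
`∑_q ∑_{ℓ ∈ L} h_q (x + ℓ) = (vol (fdom L))⁻¹ ∑ₖ (∑_q 𝓕 h_q (dualVec L k)) · echar L k x`.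
[cite: Grafakos2014, Thm 3.2.8] -/
theorem hasSum_echar_tsum_tsum_of_summable {ι : Type*} [Countable ι] {h : ι → E → ℂ}
    (hc : ∀ q, Continuous (h q)) (hint : ∀ q, Integrable (h q))
    {M : ι → L → ℝ} (hM : Summable (Function.uncurry M)) {R : ℝ} (hR : ∀ x ∈ fdom L, ‖x‖ + 1 ≤ R)
    (hbd : ∀ (q : ι) (ℓ : L) (x : E), ‖x‖ ≤ R → ‖h q (x + ℓ)‖ ≤ M q ℓ)
    (hF : Summable fun p : ι × (Fin (finrank ℝ E) → ℤ) => ‖𝓕 (h p.1) (dualVec L p.2)‖) (x : E) :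
    (Summable fun p : ι × L => h p.1 (x + p.2)) ∧
      HasSum (fun k : Fin (finrank ℝ E) → ℤ =>
        (((volume.real (fdom L))⁻¹ : ℝ) : ℂ) * (∑' q, 𝓕 (h q) (dualVec L k)) * echar L k x)
        (∑' q, ∑' ℓ : L, h q (x + ℓ)) := by
  refine ⟨?_, ?_⟩
  · -- joint summability of the translates at `x`: move `x` into the fundamental domain
    set x₀ : E := ZSpan.fract (rBasis L) x with hx₀
    have hx₀mem : x₀ ∈ fdom L := ZSpan.fract_mem_fundamentalDomain (rBasis L) x
    have hℓ₀ : x - x₀ ∈ L := by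
      have h1 : x - x₀ = (ZSpan.floor (rBasis L) x : E) := by
        rw [hx₀, ZSpan.fract_apply, sub_sub_cancel]
      rw [h1]
      exact (rBasis_span L).le (ZSpan.floor (rBasis L) x).2
    have hxR : ‖x₀‖ ≤ R := by linarith [hR x₀ hx₀mem]
    -- the dominating family, reindexed by the translation `ℓ ↦ (x - x₀) + ℓ` of `L`
    have hMs : Summable fun p : ι × L => M p.1 ((⟨x - x₀, hℓ₀⟩ : L) + p.2) :=
      (Equiv.summable_iff (Equiv.prodCongr (Equiv.refl ι) (Equiv.addLeft (⟨x - x₀, hℓ₀⟩ : L)))).2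
        hM
    refine Summable.of_norm_bounded hMs fun p => ?_
    have h1 : x + (p.2 : E) = x₀ + ((((⟨x - x₀, hℓ₀⟩ : L) + p.2 : L)) : E) := by
      simp only [Submodule.coe_add]
      abel
    rw [h1]
    exact hbd p.1 _ x₀ hxR
  · -- the volume factor
    set c : ℂ := (((volume.real (fdom L))⁻¹ : ℝ) : ℂ) with hc_def
    -- Poisson summation for each `h_q` (the one-function theorem)
    have hq : ∀ q, HasSum (fun k : Fin (finrank ℝ E) → ℤ => c * 𝓕 (h q) (dualVec L k) * echar L k x)
        (∑' ℓ : L, h q (x + ℓ)) := fun q =>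
      hasSum_echar_tsum_of_summable L (hc q) (hint q) (hM.prod_factor q) hR (hbd q)
        (hF.prod_factor q) x
    -- the double family `(q, k) ↦ c · 𝓕 h_q (dualVec L k) · echar L k x` is absolutely summable
    have hFs : Summable fun p : ι × (Fin (finrank ℝ E) → ℤ) =>
        c * 𝓕 (h p.1) (dualVec L p.2) * echar L p.2 x := by
      refine Summable.of_norm ?_
      simp only [norm_mul, norm_echar, mul_one]
      exact hF.mul_left _
    -- summing first over `k` (for each `q`) gives `∑_q ∑_ℓ h_q (x + ℓ)`
    have htot : HasSum (fun q => ∑' ℓ : L, h q (x + ℓ))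
        (∑' p : ι × (Fin (finrank ℝ E) → ℤ), c * 𝓕 (h p.1) (dualVec L p.2) * echar L p.2 x) :=
      hFs.hasSum.prod_fiberwise hq
    rw [htot.tsum_eq]
    -- summing first over `q` (for each `k`) gives the claimed series
    have hswap : HasSum (fun p : (Fin (finrank ℝ E) → ℤ) × ι =>
        c * 𝓕 (h p.2) (dualVec L p.1) * echar L p.1 x)
        (∑' p : ι × (Fin (finrank ℝ E) → ℤ), c * 𝓕 (h p.1) (dualVec L p.2) * echar L p.2 x) :=
      (Equiv.hasSum_iff (Equiv.prodComm (Fin (finrank ℝ E) → ℤ) ι)).2 hFs.hasSum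
    refine hswap.prod_fiberwise fun k => ?_
    have hsk : Summable fun q => 𝓕 (h q) (dualVec L k) :=
      Summable.of_norm (hF.prod_symm.prod_factor k)
    exact (hsk.hasSum.mul_left c).mul_right (echar L k x)

end Literature.Algebra.EuclideanLattices.LatticePeriodic
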